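import Summits.ValiantsHypothesis.ValiantsHypothesis.Theorems.GrenetZeonDualUnipotentThreeHalvesHeavyTopWeightThinBlocks

/-!
# `GrenetZeon.DualUnipotentThreeHalves` (stmt-ValiantsHypothesis-24318), R2 `HeavyTopLaw`, line `krylov_seed` (24318 WAVE-2 #1,
# lead val-port-2 g2): stub S3 `stub_invariantFlagLocus : FlagWeightLaw` — THE INVARIANT-FLAG LOCUS IS WEIGHT-THIN
# (Theorem G's graded Gerstenhaber COUNT in weight currency)

The line's `FlagWeightLaw` says: every affine nilpotent pencil with a CHEAP BLOCK FLAG — a constant change of basis `P` and a level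
function `lvl < p` making the pencil block upper triangular with `p·n + Σ_{t<p} C(m_t, 2) < n²` (`m_t = #{i : lvl i = t}`; the
hypothesis shape of ✓ `HeavyTopInvariantFlag.flagCheap_of_invariant_levels`, verbatim) — is `KrylovSeed.WeightThin` (drop `0`,
climb `1`).  The G-core SHAPE («`K` given») is ✓ p653819 `KrylovSeed.weightThin_of_block_levels`; what this file adds is the COUNT
producing `K`: the direction space `K = {v : every diagonal block of P·N_lin(v)·P⁻¹ vanishes}` has codimension `≤ Σ_t C(m_t, 2)` by
Gerstenhaber on each diagonal-block space (✓ `Literature…finrank_le_choose_two`; the blocks of conjugated nilpotent block-upper tops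
are nilpotent, ✓ `isNilpotent_reindex_toBlock`) — val-port-3 g2's Theorem G proof, re-run to the `WeightThin` conclusion.

* `weightThin_of_invariant_levels` — the count, for a given `(P, lvl, p)`;
* `flagWeightLaw_unfolded` — the ∀-closure in the shape of the line's `FlagWeightLaw` (`HasCheapBlockFlag` unfolded as `∃ P lvl p, …`).

HONEST LABEL: closes the line's stub S3 (the invariant-flag locus; restricted class); the research stub S1 (`ResidualWeightLaw`, the
no-cheap-block-flag locus), C⁺ = `UniformWeightLaw`, R2 `HeavyTopLaw` and 24318 stay OPEN; `VP ≠ VNP` is NOT proved; no summit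
statement is proved here.  No definitions, no named facts.  Writer val-port-4 g2 (second hand, desk #314; lead val-port-2 g2;
vocabulary val-idea-26, `WeightThin` def ✓ p652777).  [folklore + Gerstenhaber 1958 via the tree]
-/

noncomputable section

-- single-conjunct layout: Sub = Summit, duplicated namespace component intended
set_option linter.dupNamespace false

namespace Summit.ValiantsHypothesis.ValiantsHypothesis.Theorems.GrenetZeon.KrylovSeed

open MvPolynomial Matrix
open scoped BigOperators
open Summit.ValiantsHypothesis.ValiantsHypothesis.Cruxes.TwoDimCoefficients.DimTwoCases (AffMat IsAffine)
open Summit.ValiantsHypothesis.ValiantsHypothesis.Theorems.GrenetZeon.RadicalSplit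
open Summit.ValiantsHypothesis.ValiantsHypothesis.Theorems.GrenetZeon.HeavyTopInvariantFlag
open Summit.ValiantsHypothesis.ValiantsHypothesis.Theorems.DualUnipotentThreeHalvesNegative.FlagCost
  (coeff_aeval_line_eq_zero_of_two_le map_conj_algHom coeff_conj_apply top_map_aeval_line_eq_linPart)
open Literature.LinearAlgebra.Matrix.GerstenhaberNilpotentSubspace (finrank_le_choose_two)

variable {m : ℕ}

set_option maxHeartbeats 800000 in
/-- **The invariant-flag locus is weight-thin (Theorem G's count in weight currency).**  If the affine nilpotent pencil `N` is
block upper triangular after the constant change of basis `P` for the level function `lvl` with `p ≥ 1` levels and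
`p·n + Σ_{t<p} C(#{i : lvl i = t}, 2) < n²`, then `WeightThin n m N` (drop `0`, climb `1`, direction space = the tops whose
diagonal blocks vanish). [folklore; val-port-3 g2's Theorem G + ✓ `weightThin_of_block_levels`] -/
theorem weightThin_of_invariant_levels {n : ℕ} (N : AffMat n m) (hN : IsAffine N) (hnil : N ^ m = 0)
    (P : (Matrix (Fin m) (Fin m) ℂ)ˣ) (lvl : Fin m → ℕ) (p : ℕ) (hp : 1 ≤ p) (hlvl : ∀ i, lvl i < p)
    (hblock : ∀ i j : Fin m, lvl i < lvl j →
      ((P : Matrix (Fin m) (Fin m) ℂ).map C * N * (↑P⁻¹ : Matrix (Fin m) (Fin m) ℂ).map C :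
        Matrix (Fin m) (Fin m) (MvPolynomial (Fin n × Fin n) ℂ)) i j = 0)
    (hbudget : p * n + ∑ t ∈ Finset.range p, (Fintype.card {i : Fin m // lvl i = t}).choose 2 < n ^ 2) :
    WeightThin n m N := by
  classical
  -- the conjugated top map
  obtain ⟨T₀, hT₀⟩ := exists_topMap_linPart N hN
  let T : (Fin n × Fin n → ℂ) →ₗ[ℂ] Matrix (Fin m) (Fin m) ℂ :=
    (LinearMap.mulRight ℂ (↑P⁻¹ : Matrix (Fin m) (Fin m) ℂ)) ∘ₗ
      (LinearMap.mulLeft ℂ (P : Matrix (Fin m) (Fin m) ℂ)) ∘ₗ T₀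
  have hT : ∀ v, T v = (P : Matrix (Fin m) (Fin m) ℂ) * linPart N v * (↑P⁻¹ : Matrix (Fin m) (Fin m) ℂ) := by
    intro v
    simp only [T, LinearMap.coe_comp, Function.comp_apply, LinearMap.mulLeft_apply, LinearMap.mulRight_apply, hT₀]
  -- every conjugated top is block upper and nilpotent
  have hTblock : ∀ v i j, lvl i < lvl j → T v i j = 0 := by
    intro v i j hij
    rw [hT]
    exact conj_linPart_apply_eq_zero N _ _ i j (hblock i j hij) v
  have hTnil : ∀ v, T v ^ m = 0 := by
    intro v
    have hconj : ∀ k : ℕ, ((P : Matrix (Fin m) (Fin m) ℂ) * linPart N v * (↑P⁻¹ : Matrix (Fin m) (Fin m) ℂ)) ^ k =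
        (P : Matrix (Fin m) (Fin m) ℂ) * linPart N v ^ k * (↑P⁻¹ : Matrix (Fin m) (Fin m) ℂ) := fun k => Units.conj_pow P _ k
    rw [hT, hconj, linPart_pow_eq_zero N hN hnil v, Matrix.mul_zero, Matrix.zero_mul]
  -- the block spaces: sizes, reindexing, and the diagonal-block maps
  let sz : Fin p → ℕ := fun t => Fintype.card {i : Fin m // lvl i = (t : ℕ)}
  let e : ∀ t : Fin p, {i : Fin m // lvl i = (t : ℕ)} ≃ Fin (sz t) := fun t => Fintype.equivFin _
  let blk : ∀ t : Fin p, Matrix (Fin m) (Fin m) ℂ →ₗ[ℂ] Matrix (Fin (sz t)) (Fin (sz t)) ℂ := fun t =>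
    (Matrix.reindexAlgEquiv ℂ ℂ (e t)).toLinearEquiv.toLinearMap ∘ₗ
      { toFun := fun A => A.toBlock (fun i => lvl i = (t : ℕ)) (fun i => lvl i = (t : ℕ))
        map_add' := fun A B => rfl
        map_smul' := fun c A => rfl }
  have hblk : ∀ (t : Fin p) (A : Matrix (Fin m) (Fin m) ℂ),
      blk t A = Matrix.reindexAlgEquiv ℂ ℂ (e t) (A.toBlock (fun i => lvl i = (t : ℕ)) (fun i => lvl i = (t : ℕ))) :=
    fun t A => rfl
  let Φ : (Fin n × Fin n → ℂ) →ₗ[ℂ] (∀ t : Fin p, Matrix (Fin (sz t)) (Fin (sz t)) ℂ) :=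
    LinearMap.pi fun t => blk t ∘ₗ T
  have hΦ : ∀ v t, Φ v t = blk t (T v) := fun v t => rfl
  -- Gerstenhaber on each block space
  have hD : ∀ t : Fin p, Module.finrank ℂ (LinearMap.range (blk t ∘ₗ T)) ≤ (sz t).choose 2 := by
    intro t
    refine finrank_le_choose_two (sz t) _ fun A hA => ?_
    obtain ⟨v, rfl⟩ := LinearMap.mem_range.1 hA
    rw [LinearMap.comp_apply, hblk]
    exact isNilpotent_reindex_toBlock lvl (T v) (hTblock v) (hTnil v) (t : ℕ) (e t)
  -- the range of `Φ` embeds into the product of the block spaces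
  have hrange : Module.finrank ℂ (LinearMap.range Φ) ≤ ∑ t : Fin p, (sz t).choose 2 := by
    let ι : LinearMap.range Φ →ₗ[ℂ] (∀ t : Fin p, LinearMap.range (blk t ∘ₗ T)) :=
      LinearMap.pi fun t =>
        { toFun := fun x => ⟨x.1 t, by
            obtain ⟨v, hv⟩ := LinearMap.mem_range.1 x.2
            exact LinearMap.mem_range.2 ⟨v, by rw [← hv]; rfl⟩⟩
          map_add' := fun x y => rfl
          map_smul' := fun c x => rfl }
    have hι : Function.Injective ι := by
      intro x y hxy
      apply Subtype.ext
      funext t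
      have := congr_arg (fun f => ((f t : LinearMap.range (blk t ∘ₗ T)) : Matrix (Fin (sz t)) (Fin (sz t)) ℂ))
        hxy
      exact this
    calc Module.finrank ℂ (LinearMap.range Φ)
        ≤ Module.finrank ℂ (∀ t : Fin p, LinearMap.range (blk t ∘ₗ T)) :=
          LinearMap.finrank_le_finrank_of_injective hι
      _ = ∑ t : Fin p, Module.finrank ℂ (LinearMap.range (blk t ∘ₗ T)) := Module.finrank_pi_fintype ℂ
      _ ≤ ∑ t : Fin p, (sz t).choose 2 := Finset.sum_le_sum fun t _ => hD t
  have hsum : ∑ t : Fin p, (sz t).choose 2 = ∑ t ∈ Finset.range p, (Fintype.card {i : Fin m // lvl i = t}).choose 2 :=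
    Fin.sum_univ_eq_sum_range (fun t => (Fintype.card {i : Fin m // lvl i = t}).choose 2) p
  -- feed the G-core shape with `K = ker Φ`
  refine weightThin_of_block_levels N hN P lvl p hp hlvl hblock (LinearMap.ker Φ) (fun v hv i j he => ?_) ?_
  · have hv0 : Φ v = 0 := LinearMap.mem_ker.mp hv
    have hb : blk ⟨lvl i, hlvl i⟩ (T v) = 0 := by rw [← hΦ, hv0]; rfl
    rw [hblk, map_eq_zero_iff _ (Matrix.reindexAlgEquiv ℂ ℂ _).injective] at hb
    have h0 := congr_fun (congr_fun hb ⟨i, rfl⟩) ⟨j, he.symm⟩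
    rw [Matrix.toBlock_apply, Matrix.zero_apply] at h0
    rw [← hT]; exact h0
  · have h1 := LinearMap.finrank_range_add_finrank_ker Φ
    have h3 : Module.finrank ℂ (Fin n × Fin n → ℂ) = n * n := by
      rw [Module.finrank_fintype_fun_eq_card, Fintype.card_prod, Fintype.card_fin]
    have h4 : n ^ 2 = n * n := sq n
    rw [← hsum] at hbudget
    omega

/-- **S3 of the line `krylov_seed`, UNFOLDED** — literally the body of the line's `FlagWeightLaw` with `HasCheapBlockFlag n m N`
δ-unfolded (budget in the `Finset.filter`-card currency of the line file): every affine nilpotent pencil with a cheap block flag is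
`WeightThin`.  The lead wires `stub_invariantFlagLocus := KrylovSeed.flagWeightLaw_unfolded`. [this file] -/
theorem flagWeightLaw_unfolded :
    ∀ (n m : ℕ) (N : AffMat n m), IsAffine N → N ^ m = 0 →
      (∃ (P : (Matrix (Fin m) (Fin m) ℂ)ˣ) (lvl : Fin m → ℕ) (p : ℕ), 1 ≤ p ∧ (∀ i, lvl i < p) ∧
        (∀ i j : Fin m, lvl i < lvl j →
          ((P : Matrix (Fin m) (Fin m) ℂ).map C * N * (↑P⁻¹ : Matrix (Fin m) (Fin m) ℂ).map C :
            Matrix (Fin m) (Fin m) (MvPolynomial (Fin n × Fin n) ℂ)) i j = 0) ∧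
        p * n + ∑ t ∈ Finset.range p, ((Finset.univ.filter fun i => lvl i = t).card).choose 2 < n ^ 2) →
      WeightThin n m N := by
  classical
  intro n m N hN hnil ⟨P, lvl, p, hp, hlvl, hblock, hbudget⟩
  refine weightThin_of_invariant_levels N hN hnil P lvl p hp hlvl hblock ?_
  have h : ∀ t, Fintype.card {i : Fin m // lvl i = t} = (Finset.univ.filter fun i => lvl i = t).card :=
    fun t => Fintype.card_subtype _
  simp only [h]
  exact hbudget

end Summit.ValiantsHypothesis.ValiantsHypothesis.Theorems.GrenetZeon.KrylovSeed

end
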